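import Mathlib
import HarnessLib

/-!
# `PencilRigidity.NPointIsotropy`, line `complex-rotation-bandlimit`: off-diagonal cut-off family

Stub `offDiagCutoffFamily` of crux `stmt-QuantumFields-11686`
(`Summit.QuantumFields.YangMills.Theses.PencilRigidity.NPointIsotropy`), line `complex-rotation-bandlimit`
(lead c1, wave 2, step A1). Pure calculus over Mathlib on the configuration space
`(Fin n → EuclideanSpace ℝ (Fin 4))` (sup norm over `Fin n` of Euclidean norms); no definitions and
no notation are introduced.

Informal statement. For every `n` there are constants `C l` and smooth functions
`ψ_k : (ℝ⁴)ⁿ → [0, 1]` (`k ∈ ℕ`) with `ψ_k(x) = 1` whenever all `‖xᵢ - xⱼ‖ ≥ 2/(k+1)` (`i ≠ j`),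
`ψ_k(x) = 0` whenever some `‖xᵢ - xⱼ‖ ≤ 1/(k+1)` (`i ≠ j`), and `‖Dˡ ψ_k(x)‖ ≤ C l (k+1)ˡ`
uniformly in `x` and `k`: a cut-off family killing a shrinking neighbourhood of the coincidence
locus `{x | ∃ i ≠ j, xᵢ = xⱼ}`.

Proof. Take a smooth bump `χ` on `ℝ⁴` equal to `1` on the closed unit ball and supported in the ball
of radius `2` (`ContDiffBump`), and put `g = 1 - χ`; all derivatives of `g` are bounded (those of
`χ` are continuous with compact support). The unscaled cut-off is the finite product
`Ψ(x) = ∏_{i ≠ j} g(xᵢ - xⱼ)`: it is smooth, `[0, 1]`-valued, equal to `1` when all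
`‖xᵢ - xⱼ‖ ≥ 2` and to `0` when some `‖xᵢ - xⱼ‖ ≤ 1`, and every derivative of `Ψ` is bounded on the
whole space by the Leibniz bound for products (`norm_iteratedFDeriv_prod_le`) and the chain rule for
the linear maps `x ↦ xᵢ - xⱼ` (`ContinuousLinearMap.iteratedFDeriv_comp_right`). Finally
`ψ_k(x) = Ψ((k+1) x)`, and `Dˡ(Ψ ∘ L) = (Dˡ Ψ ∘ L) ∘ (L, …, L)` for the dilation `L = (k+1) · id` of
norm `≤ k+1` gives the factor `(k+1)ˡ`. References: folklore (L. Hörmander, The Analysis of Linear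
Partial Differential Operators I (1990), §1.4, cut-off functions). [folklore]
-/

noncomputable section

open scoped ContDiff
open Metric

namespace Summit.QuantumFields.YangMills.Theorems.NPointIsotropy.ComplexRotationBandlimit

/-! ## Functions with globally bounded derivatives of every order -/

/-- Precomposition with a continuous linear map preserves "smooth with all derivatives globally
bounded": `‖Dᵐ(g ∘ T) x‖ ≤ ‖Dᵐ g (T x)‖ ‖T‖ᵐ`. [folklore] -/
theorem bddDerivs_comp_clm {E F : Type*} [NormedAddCommGroup E] [NormedSpace ℝ E]
    [NormedAddCommGroup F] [NormedSpace ℝ F] {g : F → ℝ} (hg : ContDiff ℝ ∞ g)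
    (hB : ∀ m : ℕ, ∃ B : ℝ, ∀ y, ‖iteratedFDeriv ℝ m g y‖ ≤ B) (T : E →L[ℝ] F) :
    ∀ m : ℕ, ∃ B : ℝ, ∀ x, ‖iteratedFDeriv ℝ m (g ∘ ⇑T) x‖ ≤ B := by
  intro m
  obtain ⟨B, hB⟩ := hB m
  refine ⟨B * ‖T‖ ^ m, fun x => ?_⟩
  rw [T.iteratedFDeriv_comp_right hg x (mod_cast le_top)]
  refine (ContinuousMultilinearMap.norm_compContinuousLinearMap_le _ _).trans ?_
  rw [Finset.prod_const, Finset.card_univ, Fintype.card_fin]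
  exact mul_le_mul_of_nonneg_right (hB _) (by positivity)

/-- A finite product of smooth functions with all derivatives globally bounded has all derivatives
globally bounded (Leibniz bound `norm_iteratedFDeriv_prod_le`). [folklore] -/
theorem bddDerivs_prod {E : Type*} [NormedAddCommGroup E] [NormedSpace ℝ E] {ι : Type*}
    (u : Finset ι) {f : ι → E → ℝ} (hf : ∀ j ∈ u, ContDiff ℝ ∞ (f j))
    (hB : ∀ j ∈ u, ∀ m : ℕ, ∃ B : ℝ, ∀ x, ‖iteratedFDeriv ℝ m (f j) x‖ ≤ B) :
    ∀ m : ℕ, ∃ B : ℝ, ∀ x, ‖iteratedFDeriv ℝ m (fun x => ∏ j ∈ u, f j x) x‖ ≤ B := by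
  classical
  choose! Bf hBf using hB
  intro m
  refine ⟨∑ p ∈ u.sym m, ((p : Multiset ι).countPerms : ℝ) *
      ∏ j ∈ u, Bf j ((p : Multiset ι).count j), fun x => ?_⟩
  refine (norm_iteratedFDeriv_prod_le hf (mod_cast le_top)).trans ?_
  refine Finset.sum_le_sum fun p _ => ?_
  refine mul_le_mul_of_nonneg_left ?_ (by positivity)
  exact Finset.prod_le_prod (fun j _ => norm_nonneg _) fun j hj => hBf j hj _ x

/-! ## The radial cut-off on `ℝ⁴` and the unscaled product cut-off -/

/-- A smooth `g : ℝ⁴ → [0, 1]` vanishing on the closed unit ball, equal to `1` outside the ball of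
radius `2`, with all derivatives globally bounded (`g = 1 - χ` for a smooth bump `χ`). [folklore] -/
theorem exists_radial_cutoff :
    ∃ g : EuclideanSpace ℝ (Fin 4) → ℝ, ContDiff ℝ ∞ g ∧ (∀ u, g u ∈ Set.Icc (0 : ℝ) 1) ∧
      (∀ u, ‖u‖ ≤ 1 → g u = 0) ∧ (∀ u, 2 ≤ ‖u‖ → g u = 1) ∧
      ∀ m : ℕ, ∃ B : ℝ, ∀ u, ‖iteratedFDeriv ℝ m g u‖ ≤ B := by
  let χ : ContDiffBump (0 : EuclideanSpace ℝ (Fin 4)) := ⟨1, 2, one_pos, one_lt_two⟩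
  have hχ : ContDiff ℝ ∞ (χ : EuclideanSpace ℝ (Fin 4) → ℝ) := χ.contDiff
  refine ⟨fun u => 1 - χ u, contDiff_const.sub hχ,
    fun u => ⟨sub_nonneg.2 χ.le_one, sub_le_self _ χ.nonneg⟩, fun u hu => ?_, fun u hu => ?_,
    fun m => ?_⟩
  · show 1 - χ u = 0
    rw [χ.one_of_mem_closedBall (mem_closedBall_zero_iff.2 hu), sub_self]
  · show 1 - χ u = 1
    rw [χ.zero_of_le_dist (by rwa [dist_zero_right]), sub_zero]
  · obtain ⟨B, hB⟩ := (hχ.continuous_iteratedFDeriv (m := m)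
      (mod_cast le_top)).bounded_above_of_compact_support (χ.hasCompactSupport.iteratedFDeriv m)
    refine ⟨1 + B, fun u => ?_⟩
    have hsub : (fun u => 1 - χ u) = (fun _ => (1 : ℝ)) - (χ : EuclideanSpace ℝ (Fin 4) → ℝ) :=
      rfl
    rw [hsub, iteratedFDeriv_sub_apply contDiffAt_const χ.contDiff.contDiffAt]
    refine (norm_sub_le _ _).trans (add_le_add ?_ (hB u))
    rcases Nat.eq_zero_or_pos m with rfl | hm
    · simp
    · simp [iteratedFDeriv_const_of_ne hm.ne']

/-- The unscaled off-diagonal cut-off `Ψ(x) = ∏_{i ≠ j} g(xᵢ - xⱼ)` on `(ℝ⁴)ⁿ`: smooth,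
`[0, 1]`-valued, `= 1` when all `‖xᵢ - xⱼ‖ ≥ 2`, `= 0` when some `‖xᵢ - xⱼ‖ ≤ 1`, with every
derivative globally bounded. [folklore] -/
theorem exists_unscaled_cutoff (n : ℕ) :
    ∃ (C : ℕ → ℝ) (Ψ : (Fin n → EuclideanSpace ℝ (Fin 4)) → ℝ), ContDiff ℝ ∞ Ψ ∧
      (∀ x, Ψ x ∈ Set.Icc (0 : ℝ) 1) ∧
      (∀ x, (∀ i j : Fin n, i ≠ j → 2 ≤ ‖x i - x j‖) → Ψ x = 1) ∧
      (∀ x, (∃ i j : Fin n, i ≠ j ∧ ‖x i - x j‖ ≤ 1) → Ψ x = 0) ∧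
      ∀ (l : ℕ) x, ‖iteratedFDeriv ℝ l Ψ x‖ ≤ C l := by
  obtain ⟨g, hg, hg01, hg0, hg1, hgB⟩ := exists_radial_cutoff
  obtain ⟨T, hT⟩ : ∃ T : Fin n × Fin n →
      (Fin n → EuclideanSpace ℝ (Fin 4)) →L[ℝ] EuclideanSpace ℝ (Fin 4),
      ∀ p x, T p x = x p.1 - x p.2 :=
    ⟨fun p =>
      ContinuousLinearMap.proj (R := ℝ) (φ := fun _ : Fin n => EuclideanSpace ℝ (Fin 4)) p.1 -
        ContinuousLinearMap.proj (R := ℝ) (φ := fun _ : Fin n => EuclideanSpace ℝ (Fin 4)) p.2,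
      fun p x => rfl⟩
  obtain ⟨P, hP⟩ : ∃ P : Finset (Fin n × Fin n), ∀ p, p ∈ P ↔ p.1 ≠ p.2 :=
    ⟨Finset.univ.filter fun p => p.1 ≠ p.2, fun p => by simp⟩
  have hsm : ∀ p ∈ P, ContDiff ℝ ∞ (g ∘ ⇑(T p)) := fun p _ => hg.comp (T p).contDiff
  have hbd : ∀ p ∈ P, ∀ m : ℕ, ∃ B : ℝ, ∀ x, ‖iteratedFDeriv ℝ m (g ∘ ⇑(T p)) x‖ ≤ B :=
    fun p _ => bddDerivs_comp_clm hg hgB (T p)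
  choose C hC using bddDerivs_prod P hsm hbd
  refine ⟨C, fun x => ∏ p ∈ P, (g ∘ ⇑(T p)) x, contDiff_prod hsm, fun x => ?_, fun x hx => ?_,
    fun x hx => ?_, hC⟩
  · exact ⟨Finset.prod_nonneg fun p _ => (hg01 _).1,
      Finset.prod_le_one (fun p _ => (hg01 _).1) fun p _ => (hg01 _).2⟩
  · refine Finset.prod_eq_one fun p hp => hg1 _ ?_
    rw [hT]
    exact hx p.1 p.2 ((hP p).1 hp)
  · obtain ⟨i, j, hij, hle⟩ := hx
    refine Finset.prod_eq_zero ((hP (i, j)).2 hij) (hg0 _ ?_)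
    rwa [hT]

/-! ## The scaled family -/

/-- **Off-diagonal cut-off family** (step A1 of the off-diagonal tensor density theorem): smooth
`ψ_k : (ℝ⁴)ⁿ → [0, 1]`, `= 1` when all `‖xᵢ - xⱼ‖ ≥ 2/(k+1)`, `= 0` when some `‖xᵢ - xⱼ‖ ≤ 1/(k+1)`
(`i ≠ j`), with `‖Dˡ ψ_k‖ ≤ C l (k+1)ˡ`; here `ψ_k(x) = Ψ((k+1) x)` for the unscaled cut-off `Ψ`.
[folklore] -/
theorem offDiagCutoffFamily : ∀ (n : ℕ), ∃ (C : ℕ → ℝ) (ψ : ℕ → (Fin n → EuclideanSpace ℝ (Fin 4)) → ℝ), (∀ k : ℕ, ContDiff ℝ (⊤ : ℕ∞) (ψ k)) ∧ (∀ (k : ℕ) (x : (Fin n → EuclideanSpace ℝ (Fin 4))), ψ k x ∈ Set.Icc (0 : ℝ) 1) ∧ (∀ (k : ℕ) (x : (Fin n → EuclideanSpace ℝ (Fin 4))), (∀ i j : Fin n, i ≠ j → 2 / ((k : ℝ) + 1) ≤ ‖x i - x j‖) → ψ k x = 1) ∧ (∀ (k : ℕ) (x : (Fin n → EuclideanSpace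 ℝ (Fin 4))), (∃ i j : Fin n, i ≠ j ∧ ‖x i - x j‖ ≤ 1 / ((k : ℝ) + 1)) → ψ k x = 0) ∧ (∀ (k l : ℕ) (x : (Fin n → EuclideanSpace ℝ (Fin 4))), ‖iteratedFDeriv ℝ l (ψ k) x‖ ≤ C l * ((k : ℝ) + 1) ^ l) := by
  intro n
  obtain ⟨C, Ψ, hΨ, hΨ01, hΨ1, hΨ0, hC⟩ := exists_unscaled_cutoff n
  have hk : ∀ k : ℕ, (0 : ℝ) < (k : ℝ) + 1 := fun k => by positivity
  have hC0 : ∀ l, 0 ≤ C l := fun l => (norm_nonneg _).trans (hC l 0)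
  -- the dilations `L k = (k+1) • id`
  obtain ⟨L, hL⟩ : ∃ L : ℕ →
      (Fin n → EuclideanSpace ℝ (Fin 4)) →L[ℝ] (Fin n → EuclideanSpace ℝ (Fin 4)),
      ∀ k, L k = ((k : ℝ) + 1) • ContinuousLinearMap.id ℝ (Fin n → EuclideanSpace ℝ (Fin 4)) :=
    ⟨_, fun k => rfl⟩
  have hL_apply : ∀ k x (i : Fin n), L k x i = ((k : ℝ) + 1) • x i := fun k x i => by
    simp [hL]
  have hL_sub : ∀ k x (i j : Fin n), ‖L k x i - L k x j‖ = ((k : ℝ) + 1) * ‖x i - x j‖ := by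
    intro k x i j
    rw [hL_apply, hL_apply, ← smul_sub, norm_smul, Real.norm_of_nonneg (hk k).le]
  have hL_norm : ∀ k, ‖L k‖ ≤ (k : ℝ) + 1 := fun k => by
    rw [hL]
    refine (ContinuousLinearMap.opNorm_smul_le _ _).trans ?_
    rw [Real.norm_of_nonneg (hk k).le]
    exact mul_le_of_le_one_right (hk k).le ContinuousLinearMap.norm_id_le
  refine ⟨C, fun k => Ψ ∘ ⇑(L k), fun k => hΨ.comp (L k).contDiff, fun k x => hΨ01 _,
    fun k x hx => ?_, fun k x hx => ?_, fun k l x => ?_⟩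
  · refine hΨ1 _ fun i j hij => ?_
    rw [hL_sub, ← div_le_iff₀' (hk k)]
    exact hx i j hij
  · obtain ⟨i, j, hij, hle⟩ := hx
    refine hΨ0 _ ⟨i, j, hij, ?_⟩
    rw [hL_sub, ← le_div_iff₀' (hk k)]
    exact hle
  · rw [(L k).iteratedFDeriv_comp_right hΨ x (mod_cast le_top)]
    refine (ContinuousMultilinearMap.norm_compContinuousLinearMap_le _ _).trans ?_
    rw [Finset.prod_const, Finset.card_univ, Fintype.card_fin]
    exact mul_le_mul (hC l _) (pow_le_pow_left₀ (norm_nonneg _) (hL_norm k) l) (by positivity)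
      (hC0 l)

end Summit.QuantumFields.YangMills.Theorems.NPointIsotropy.ComplexRotationBandlimit

end
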